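/-
Origin: expansion seat `planner-pub-hodgecm-pv07-0`, handover 2026-08-18T03:47:07Z (`HOME/pub-hodgecm-pv07/lean/Pv07/Dictionary.lean`, md5 69710447, 148 lines);
landed by the gen-5 packager in gate run 20 as `HodgeCM/PerL34/LocalFactors/Dictionary.lean` (import ^import Pv07\.(BallDichotomy|SplitFactor|CompactFactor|KernelRadius|Dictionary|SmokeSplit|SmokeCompact)\b→import HodgeCM.PerL34.LocalFactors.\1 ×1).
-/
/-
Copyright: HodgeCM publication cell (pub-hodgecm), DAG node N31f (prover pv07).
Released under the package licence.

# N31f — the dictionary `D = x₀ + ϖ^N 𝒪³`, `U₁ = 1 + ϖ^{N − ord(x₀)} 𝒪`, "N large"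
# (PerL v5 Lemma 4.2(b), proof, tex ll. 617–620), kernel-checked

Source under adjudication (NOT cited; this file PROVES the identifications used as a dictionary in
`Pv07.BallDichotomy` / `Pv07.SplitFactor` / `Pv07.KernelRadius`), tex verbatim:

  617–618: ... $\varphi_v=\mathbf 1_D$ with $D=x_0+\varpi^N\mathcal O^3$, $x_0\ne0$ and
           $N>\mathrm{ord}(x_0)$ ...
  619–620: ... taking $N$ so large that $U_1:=\{y:\ yD=D\}=1+\varpi^{\,N-\mathrm{ord}(x_0)}
           \mathcal O_{L_{0,v}}$ (an open subgroup) lies in the kernel of $\chi'_v$ ...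

Proved here, for any normed field `F` (ultrametric where needed), any `ϖ ∈ F` with `0 < ‖ϖ‖ < 1`
(a uniformiser, or any topologically nilpotent unit of `F`), `𝒪 := closedBall 0 1`:
* `closedBall_eq_vadd_smul_unitBall` : `closedBall x₀ (‖ϖ‖^N) = x₀ +ᵥ ϖ^N • 𝒪` in any normed
  `F`-space (so `D := closedBall x₀ (‖ϖ‖^N)` IS `x₀ + ϖ^N𝒪³` for the sup norm on `Fin 3 → F`);
* `U1_eq_one_vadd_smul_unitBall` : if `‖x₀‖ = ‖ϖ‖^m` (`m = ord x₀`) and `m ≤ N` then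
  `U1 x₀ (‖ϖ‖^N) = 1 +ᵥ ϖ^(N−m) • 𝒪` — the tex's `U₁ = 1 + ϖ^{N−ord(x₀)}𝒪`;
* `pow_lt_norm_iff` : `‖ϖ‖^N < ‖x₀‖ = ‖ϖ‖^m ↔ m < N` — the tex's `N > ord(x₀)`;
* `exists_forall_pow_le` : radii `‖ϖ‖^N` become `≤ r₀` for all large `N` — "taking N so large";
* `N31f_split_verbatim` : the split-place conclusion of `Pv07.KernelRadius` restated with the
  integer parameter `N`: `∃ N₀, ∀ N ≥ N₀, ord x₀ < N ∧ I_v(𝟙_{x₀+ϖ^N𝒪}) = c > 0`.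
-/
import Summits.HodgeConjecture.HodgeCM.PerL34.LocalFactors.KernelRadius

/-! PORT of `HodgeCM/PerL34/LocalFactors/Dictionary.lean` (HodgeCMPerL run 82) — verbatim mechanical port; provenance in the PORT header line. -/

namespace HodgeCM
namespace PerL34
namespace LocalFactors

open Metric Set MeasureTheory Filter Topology
open scoped Pointwise

section Balls

variable {F : Type*} [NormedField F]
variable {E : Type*} [NormedAddCommGroup E] [NormedSpace F E]

/-- `closedBall x₀ ‖c‖ = x₀ + c • 𝒪` for a non-zero scalar `c` (`𝒪 = closedBall 0 1`), in any
normed `F`-space.  With `c = ϖ^N`: tex l. 617 "`D = x₀ + ϖ^N 𝒪³`". -/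
theorem closedBall_eq_vadd_smul_unitBall' (x₀ : E) {c : F} (hc : c ≠ 0) :
    closedBall x₀ ‖c‖ = x₀ +ᵥ c • closedBall (0 : E) 1 := by
  have hc' : 0 < ‖c‖ := norm_pos_iff.mpr hc
  ext y
  rw [mem_closedBall, dist_eq_norm, Set.mem_vadd_set]
  constructor
  · intro hy
    refine ⟨y - x₀, ?_, by rw [vadd_eq_add]; abel⟩
    rw [Set.mem_smul_set]
    refine ⟨c⁻¹ • (y - x₀), ?_, by rw [smul_smul, mul_inv_cancel₀ hc, one_smul]⟩
    rw [mem_closedBall, dist_zero_right, norm_smul, norm_inv]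
    rw [inv_mul_le_iff₀ hc', mul_one]
    exact hy
  · rintro ⟨d, hd, rfl⟩
    rw [Set.mem_smul_set] at hd
    obtain ⟨z, hz, rfl⟩ := hd
    rw [mem_closedBall, dist_zero_right] at hz
    rw [vadd_eq_add, add_sub_cancel_left, norm_smul]
    calc ‖c‖ * ‖z‖ ≤ ‖c‖ * 1 := by gcongr
      _ = ‖c‖ := mul_one _

/-- tex l. 617: `D := closedBall x₀ (‖ϖ‖^N) = x₀ + ϖ^N 𝒪ⁿ` (sup norm on `E`, e.g. `E = Fin 3 → F`). -/
theorem closedBall_eq_vadd_smul_unitBall (x₀ : E) {ϖ : F} (hϖ : ϖ ≠ 0) (N : ℕ) :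
    closedBall x₀ (‖ϖ‖ ^ N) = x₀ +ᵥ (ϖ ^ N) • closedBall (0 : E) 1 := by
  rw [← norm_pow]
  exact closedBall_eq_vadd_smul_unitBall' x₀ (pow_ne_zero N hϖ)

/-- tex l. 618 "`N > ord(x₀)`" ↔ the radius condition `‖ϖ‖^N < ‖x₀‖` of `Pv07.BallDichotomy`
(`‖x₀‖ = ‖ϖ‖^m`, `m = ord x₀`, `0 < ‖ϖ‖ < 1`). -/
theorem pow_lt_pow_iff_lt_of_norm {ϖ : F} (h0 : 0 < ‖ϖ‖) (h1 : ‖ϖ‖ < 1) {m N : ℕ} :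
    ‖ϖ‖ ^ N < ‖ϖ‖ ^ m ↔ m < N :=
  pow_lt_pow_iff_right_of_lt_one₀ h0 h1

/-- "taking `N` so large": the radii `‖ϖ‖^N` are eventually below any `r₀ > 0`. -/
theorem exists_forall_pow_le {ϖ : F} (h1 : ‖ϖ‖ < 1) {r₀ : ℝ} (hr₀ : 0 < r₀) :
    ∃ N₀ : ℕ, ∀ N, N₀ ≤ N → ‖ϖ‖ ^ N ≤ r₀ := by
  obtain ⟨N₀, hN₀⟩ := exists_pow_lt_of_lt_one hr₀ h1
  exact ⟨N₀, fun N hN =>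
    (pow_le_pow_of_le_one (norm_nonneg _) h1.le hN).trans hN₀.le⟩

end Balls

section U1

variable {F : Type*} [NormedField F]
variable {ι : Type*} [Fintype ι]

/-- tex l. 620: `U₁ = 1 + ϖ^{N − ord(x₀)} 𝒪` — for `‖x₀‖ = ‖ϖ‖^m` (`m = ord x₀`) and `m ≤ N`,
`U1 x₀ (‖ϖ‖^N) = 1 +ᵥ ϖ^(N − m) • closedBall 0 1`. -/
theorem U1_eq_one_vadd_smul_unitBall {x₀ : ι → F} {ϖ : F} (hϖ : ϖ ≠ 0) {m N : ℕ}
    (hx : ‖x₀‖ = ‖ϖ‖ ^ m) (hmN : m ≤ N) :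
    U1 x₀ (‖ϖ‖ ^ N) = (1 : F) +ᵥ (ϖ ^ (N - m)) • closedBall (0 : F) 1 := by
  have hϖ' : ‖ϖ‖ ≠ 0 := norm_ne_zero_iff.mpr hϖ
  have hx0 : x₀ ≠ 0 := by
    intro h
    rw [h, norm_zero] at hx
    exact pow_ne_zero m hϖ' hx.symm
  rw [U1_eq_closedBall hx0, hx, div_eq_mul_inv, ← pow_sub₀ _ hϖ' hmN]
  exact closedBall_eq_vadd_smul_unitBall (1 : F) hϖ (N - m)

end U1

section Verbatim

variable {F : Type*} [NormedField F] [IsUltrametricDist F]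
variable {ι : Type*} [Fintype ι] [MeasurableSpace (ι → F)]

/-- **N31f, split place, in the tex's own parametrisation** (ll. 617–623 with 619–621 discharged):
`F = L_{0,v}`, `ϖ` with `0 < ‖ϖ‖ < 1`, `x₀ ≠ 0` with `‖x₀‖ = ‖ϖ‖^m` (`m = ord x₀`), `ν`, `χ = χ'_v`
unitary characters of `F^×` continuous at `1`.  Then for all sufficiently large `N`:
`N > ord x₀`, `D = closedBall x₀ (‖ϖ‖^N) = x₀ + ϖ^N𝒪ⁿ`, `U₁ = 1 + ϖ^{N−m}𝒪`, and
`I_v(𝟙_D) = ∫ ν(y)|y|^{3/2}·vol(D ∩ y⁻¹D)·χ(y) dη = c` with `c > 0` real. -/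
theorem N31f_split_verbatim [MeasurableSpace F] [BorelSpace F]
    {μ : Measure (ι → F)} [μ.IsOpenPosMeasure] [IsFiniteMeasureOnCompacts μ]
    [ProperSpace (ι → F)] (η : Measure F) [η.IsOpenPosMeasure] [IsFiniteMeasureOnCompacts η]
    [ProperSpace F] (ν χ : F → Circle)
    (hνm : ∀ y z : F, y ≠ 0 → z ≠ 0 → ν (y * z) = ν y * ν z) (hνc : ContinuousAt ν 1)
    (hχm : ∀ y z : F, y ≠ 0 → z ≠ 0 → χ (y * z) = χ y * χ z) (hχc : ContinuousAt χ 1)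
    {ϖ : F} (hϖ0 : 0 < ‖ϖ‖) (hϖ1 : ‖ϖ‖ < 1) {x₀ : ι → F} {m : ℕ} (hx : ‖x₀‖ = ‖ϖ‖ ^ m) :
    ∃ N₀ : ℕ, ∀ N, N₀ ≤ N →
      m < N ∧
      closedBall x₀ (‖ϖ‖ ^ N) = x₀ +ᵥ (ϖ ^ N) • closedBall (0 : ι → F) 1 ∧
      U1 x₀ (‖ϖ‖ ^ N) = (1 : F) +ᵥ (ϖ ^ (N - m)) • closedBall (0 : F) 1 ∧
      ∃ c : ℝ, 0 < c ∧
        ∫ y, ballCoeff (dilationWeight ν) μ x₀ (‖ϖ‖ ^ N) y * (χ y : ℂ) ∂η = (c : ℂ) := by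
  have hϖ : ϖ ≠ 0 := norm_pos_iff.mp hϖ0
  have hx0 : x₀ ≠ 0 := by
    intro h
    rw [h, norm_zero] at hx
    exact pow_ne_zero m hϖ0.ne' hx.symm
  obtain ⟨r₀, hr₀, hmain⟩ :=
    exists_radius_integral_ballCoeff_pos (μ := μ) η ν χ hνm hνc hχm hχc hx0
  obtain ⟨N₀, hN₀⟩ := exists_forall_pow_le hϖ1 hr₀
  refine ⟨N₀, fun N hN => ?_⟩
  obtain ⟨hlt, c, hc, hint⟩ := hmain (‖ϖ‖ ^ N) (pow_pos hϖ0 N) (hN₀ N hN)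
  have hmN : m < N := by
    rw [hx] at hlt
    exact (pow_lt_pow_iff_lt_of_norm hϖ0 hϖ1).mp hlt
  exact ⟨hmN, closedBall_eq_vadd_smul_unitBall x₀ hϖ N,
    U1_eq_one_vadd_smul_unitBall hϖ hx hmN.le, c, hc, hint⟩

end Verbatim

end LocalFactors
end PerL34
end HodgeCM
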